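import Mathlib
import HarnessLib
import Summits.KontsevichZagierPeriods.KontsevichZagierPeriods.Theses.LinRedNormalForm
import Summits.KontsevichZagierPeriods.KontsevichZagierPeriods.Theorems.LinRedNormalFormDihedralNormalFormStubNestedReductionAux5
import Summits.KontsevichZagierPeriods.KontsevichZagierPeriods.Theorems.LinRedNormalFormDihedralNormalFormStubAtomConvergence
import Literature.NumberTheory.Transcendental.KZProductIdeal

/-!
# `DihedralNormalForm`, line `torus-descent-sum-shadow`, stub `stub_productSplit` (v5)

The stub `stub_productSplit` of the crux `DihedralNormalForm` (stmt-KontsevichZagierPeriods-3912,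
route `LinRedNormalForm`): **PRODUCT atoms are an exit**.  A convergent cubical atom
`[□ᵏ, q·xᵃ·∏_{i≤j}(1 − x_{[i,j]})^{e i j}]` no active chord of which straddles the seam `p`
(`e i j = 0` whenever `i < p ≤ j`, `0 < p < k`) is congruent modulo `KZ.relations` to the product
`KZ.of s₁ * KZ.of s₂ = KZ.of (s₁.prod s₂)` (`KZ.of_mul_of`) of two convergent atoms of dimensions
`p` and `k − p`:
* writing `k = p + t`, the integrand FACTORISES on `ℝ^{p+t}` as
  `atomQ p q a₁ e₁ (x ∘ castAdd) · atomQ t 1 a₂ e₂ (x ∘ natAdd)` (`ProductSplit.atomQ_split`): the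
  chords `[i,j]` with `j < p` only involve the first block, those with `p ≤ i` only the second,
  the straddling ones have exponent `0`;
* both factors are absolutely convergent: the convergence criterion `atomConvergence` of the
  restricted data at `[i,j]` is the criterion of `e` at the corresponding (non-straddling)
  interval (`ProductSplit.crit_castAdd`, `ProductSplit.crit_natAdd`), which holds by the
  necessity half of `atomConvergence` applied to `s`; (`q = 0` is disposed of by zero atoms;)
* `s` and `s₁.prod s₂` have the same domain (the cube is the product of the two cubes) and the
  same integrand on it (`KZ.IntegralRep.prod_integrand_eq` + the factorisation), so they differ by
  a relation (`KZ.of_sub_of_mem_relations_of_eqOn`).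

References: M. Kontsevich, D. Zagier, *Periods* (2001), §1.1–1.2, §4.1 (Fubini); F. Brown,
*Multiple zeta values and periods of moduli spaces `𝔐_{0,n}`*, Ann. Sci. ÉNS 42 (2009), §7
(product maps of cubical type).
-/

noncomputable section

open MeasureTheory Set

namespace Summit.KontsevichZagierPeriods.DihedralNormalForm.TorusDescent

open Literature.NumberTheory.Transcendental
open Nested

namespace ProductSplit

variable {p t : ℕ}

/-! ## Block bookkeeping on `Fin (p + t)` -/

/-- A second-block index is never `≤` a first-block index. -/
theorem not_natAdd_le_castAdd (i : Fin t) (j : Fin p) : ¬ (Fin.natAdd p i ≤ Fin.castAdd t j) := by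
  rw [Fin.le_def, Fin.val_natAdd, Fin.val_castAdd]
  have := j.2
  omega

/-- A first-block index is always `≤` a second-block index. -/
theorem castAdd_le_natAdd (i : Fin p) (j : Fin t) : Fin.castAdd t i ≤ Fin.natAdd p j := by
  rw [Fin.le_def, Fin.val_natAdd, Fin.val_castAdd]
  have := i.2
  omega

/-- `castAdd` reflects `≤`. -/
theorem castAdd_le_castAdd_iff (i j : Fin p) : Fin.castAdd t i ≤ Fin.castAdd t j ↔ i ≤ j := by
  rw [Fin.le_def, Fin.le_def, Fin.val_castAdd, Fin.val_castAdd]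

/-- A chord of the first block only involves first-block coordinates. -/
theorem cp_castAdd (i j : Fin p) (x : Fin (p + t) → ℝ) :
    (∏ l : Fin (p + t), if Fin.castAdd t i ≤ l ∧ l ≤ Fin.castAdd t j then x l else 1) =
      ∏ l : Fin p, if i ≤ l ∧ l ≤ j then x (Fin.castAdd t l) else 1 := by
  rw [Fin.prod_univ_add]
  have h2 : (∏ l : Fin t, if Fin.castAdd t i ≤ Fin.natAdd p l ∧ Fin.natAdd p l ≤ Fin.castAdd t j
      then x (Fin.natAdd p l) else 1) = 1 :=
    Finset.prod_eq_one fun l _ => if_neg fun h => not_natAdd_le_castAdd l j h.2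
  rw [h2, mul_one]
  refine Finset.prod_congr rfl fun l _ => ?_
  simp only [castAdd_le_castAdd_iff]

/-- A chord of the second block only involves second-block coordinates. -/
theorem cp_natAdd (i j : Fin t) (x : Fin (p + t) → ℝ) :
    (∏ l : Fin (p + t), if Fin.natAdd p i ≤ l ∧ l ≤ Fin.natAdd p j then x l else 1) =
      ∏ l : Fin t, if i ≤ l ∧ l ≤ j then x (Fin.natAdd p l) else 1 := by
  rw [Fin.prod_univ_add]
  have h1 : (∏ l : Fin p, if Fin.natAdd p i ≤ Fin.castAdd t l ∧ Fin.castAdd t l ≤ Fin.natAdd p j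
      then x (Fin.castAdd t l) else 1) = 1 :=
    Finset.prod_eq_one fun l _ => if_neg fun h => not_natAdd_le_castAdd i l h.1
  rw [h1, one_mul]
  refine Finset.prod_congr rfl fun l _ => ?_
  simp only [Fin.natAdd_le_natAdd_iff]

/-- **The chord product splits into the two diagonal blocks** when no active chord straddles the
seam: the off-diagonal block `i < p ≤ j` has exponent `0`, the block `j < p ≤ i` is empty. -/
theorem dprod_split (e : Fin (p + t) → Fin (p + t) → ℤ)
    (hseam : ∀ i j : Fin (p + t), i ≤ j → (i : ℕ) < p → p ≤ (j : ℕ) → e i j = 0)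
    (x : Fin (p + t) → ℝ) :
    (∏ i : Fin (p + t), ∏ j : Fin (p + t), if i ≤ j then
        (1 - (∏ l : Fin (p + t), if i ≤ l ∧ l ≤ j then x l else 1)) ^ e i j else 1) =
      (∏ i : Fin p, ∏ j : Fin p, if i ≤ j then
        (1 - (∏ l : Fin p, if i ≤ l ∧ l ≤ j then x (Fin.castAdd t l) else 1)) ^
          e (Fin.castAdd t i) (Fin.castAdd t j) else 1) *
      ∏ i : Fin t, ∏ j : Fin t, if i ≤ j then
        (1 - (∏ l : Fin t, if i ≤ l ∧ l ≤ j then x (Fin.natAdd p l) else 1)) ^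
          e (Fin.natAdd p i) (Fin.natAdd p j) else 1 := by
  rw [Fin.prod_univ_add]
  congr 1
  · refine Finset.prod_congr rfl fun i _ => ?_
    rw [Fin.prod_univ_add]
    have h2 : (∏ j : Fin t, if Fin.castAdd t i ≤ Fin.natAdd p j then
        (1 - (∏ l : Fin (p + t), if Fin.castAdd t i ≤ l ∧ l ≤ Fin.natAdd p j then x l else 1)) ^
          e (Fin.castAdd t i) (Fin.natAdd p j) else (1:ℝ)) = 1 := by
      refine Finset.prod_eq_one fun j _ => ?_
      rw [if_pos (castAdd_le_natAdd i j), hseam _ _ (castAdd_le_natAdd i j) (by simp) (by simp),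
        zpow_zero]
    rw [h2, mul_one]
    refine Finset.prod_congr rfl fun j _ => ?_
    simp only [castAdd_le_castAdd_iff, cp_castAdd]
  · refine Finset.prod_congr rfl fun i _ => ?_
    rw [Fin.prod_univ_add]
    have h1 : (∏ j : Fin p, if Fin.natAdd p i ≤ Fin.castAdd t j then
        (1 - (∏ l : Fin (p + t), if Fin.natAdd p i ≤ l ∧ l ≤ Fin.castAdd t j then x l else 1)) ^
          e (Fin.natAdd p i) (Fin.castAdd t j) else (1:ℝ)) = 1 :=
      Finset.prod_eq_one fun j _ => if_neg (not_natAdd_le_castAdd i j)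
    rw [h1, one_mul]
    refine Finset.prod_congr rfl fun j _ => ?_
    simp only [Fin.natAdd_le_natAdd_iff, cp_natAdd]

/-- **Factorisation of a product atom**: `atomQ (p+t) q a e x =
atomQ p q a_L e_L (x|_L) · atomQ t 1 a_R e_R (x|_R)` (block data `a_L = a ∘ castAdd`,
`e_L = e ∘ (castAdd × castAdd)`, `a_R = a ∘ natAdd`, `e_R = e ∘ (natAdd × natAdd)`). -/
theorem atomQ_split (q : ℚ) (a : Fin (p + t) → ℕ) (e : Fin (p + t) → Fin (p + t) → ℤ)
    (hseam : ∀ i j : Fin (p + t), i ≤ j → (i : ℕ) < p → p ≤ (j : ℕ) → e i j = 0)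
    (x : Fin (p + t) → ℝ) :
    atomQ (p + t) q a e x =
      atomQ p q (fun i => a (Fin.castAdd t i)) (fun i j => e (Fin.castAdd t i) (Fin.castAdd t j))
          (fun i => x (Fin.castAdd t i)) *
        atomQ t 1 (fun i => a (Fin.natAdd p i)) (fun i j => e (Fin.natAdd p i) (Fin.natAdd p j))
          (fun j => x (Fin.natAdd p j)) := by
  simp only [atomQ]
  rw [dprod_split e hseam x, Fin.prod_univ_add (fun i => x i ^ a i)]
  push_cast
  ring

/-! ## The convergence criterion of the blocks -/

/-- The criterion sum of the first block at `[i,j]` is the criterion sum of `e` at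
`[castAdd i, castAdd j]`. -/
theorem crit_castAdd (e : Fin (p + t) → Fin (p + t) → ℤ) (i j : Fin p) :
    (∑ i' : Fin (p + t), ∑ j' : Fin (p + t),
        if Fin.castAdd t i ≤ i' ∧ i' ≤ j' ∧ j' ≤ Fin.castAdd t j then e i' j' else 0) =
      ∑ i' : Fin p, ∑ j' : Fin p,
        if i ≤ i' ∧ i' ≤ j' ∧ j' ≤ j then e (Fin.castAdd t i') (Fin.castAdd t j') else 0 := by
  rw [Fin.sum_univ_add]
  have h2 : (∑ i' : Fin t, ∑ j' : Fin (p + t), if Fin.castAdd t i ≤ Fin.natAdd p i' ∧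
      Fin.natAdd p i' ≤ j' ∧ j' ≤ Fin.castAdd t j then e (Fin.natAdd p i') j' else 0) = 0 := by
    refine Finset.sum_eq_zero fun i' _ => Finset.sum_eq_zero fun j' _ => if_neg ?_
    rintro ⟨-, h1, h2⟩
    exact not_natAdd_le_castAdd i' j (h1.trans h2)
  rw [h2, add_zero]
  refine Finset.sum_congr rfl fun i' _ => ?_
  rw [Fin.sum_univ_add]
  have h3 : (∑ j' : Fin t, if Fin.castAdd t i ≤ Fin.castAdd t i' ∧
      Fin.castAdd t i' ≤ Fin.natAdd p j' ∧ Fin.natAdd p j' ≤ Fin.castAdd t j then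
        e (Fin.castAdd t i') (Fin.natAdd p j') else 0) = 0 := by
    refine Finset.sum_eq_zero fun j' _ => if_neg ?_
    rintro ⟨-, -, h2⟩
    exact not_natAdd_le_castAdd j' j h2
  rw [h3, add_zero]
  refine Finset.sum_congr rfl fun j' _ => ?_
  simp only [castAdd_le_castAdd_iff]

/-- The criterion sum of the second block at `[i,j]` is the criterion sum of `e` at
`[natAdd i, natAdd j]`. -/
theorem crit_natAdd (e : Fin (p + t) → Fin (p + t) → ℤ) (i j : Fin t) :
    (∑ i' : Fin (p + t), ∑ j' : Fin (p + t),
        if Fin.natAdd p i ≤ i' ∧ i' ≤ j' ∧ j' ≤ Fin.natAdd p j then e i' j' else 0) =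
      ∑ i' : Fin t, ∑ j' : Fin t,
        if i ≤ i' ∧ i' ≤ j' ∧ j' ≤ j then e (Fin.natAdd p i') (Fin.natAdd p j') else 0 := by
  rw [Fin.sum_univ_add]
  have h1 : (∑ i' : Fin p, ∑ j' : Fin (p + t), if Fin.natAdd p i ≤ Fin.castAdd t i' ∧
      Fin.castAdd t i' ≤ j' ∧ j' ≤ Fin.natAdd p j then e (Fin.castAdd t i') j' else 0) = 0 := by
    refine Finset.sum_eq_zero fun i' _ => Finset.sum_eq_zero fun j' _ => if_neg ?_
    rintro ⟨h1, -, -⟩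
    exact not_natAdd_le_castAdd i i' h1
  rw [h1, zero_add]
  refine Finset.sum_congr rfl fun i' _ => ?_
  rw [Fin.sum_univ_add]
  have h3 : (∑ j' : Fin p, if Fin.natAdd p i ≤ Fin.natAdd p i' ∧
      Fin.natAdd p i' ≤ Fin.castAdd t j' ∧ Fin.castAdd t j' ≤ Fin.natAdd p j then
        e (Fin.natAdd p i') (Fin.castAdd t j') else 0) = 0 := by
    refine Finset.sum_eq_zero fun j' _ => if_neg ?_
    rintro ⟨-, h2, -⟩
    exact not_natAdd_le_castAdd i' j' h2
  rw [h3, zero_add]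
  refine Finset.sum_congr rfl fun j' _ => ?_
  simp only [Fin.natAdd_le_natAdd_iff]

/-- **Convergence of the blocks.**  If the product atom (with `q ≠ 0`) is absolutely convergent,
so are both blocks (with any coefficients). -/
theorem integrableOn_blocks {q : ℚ} (hq : q ≠ 0) (a : Fin (p + t) → ℕ)
    (e : Fin (p + t) → Fin (p + t) → ℤ) (hI : IntegrableOn (atomQ (p + t) q a e) (ocube (p + t)))
    (q₁ q₂ : ℚ) :
    IntegrableOn (atomQ p q₁ (fun i => a (Fin.castAdd t i))
        (fun i j => e (Fin.castAdd t i) (Fin.castAdd t j))) (ocube p) ∧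
      IntegrableOn (atomQ t q₂ (fun i => a (Fin.natAdd p i))
        (fun i j => e (Fin.natAdd p i) (Fin.natAdd p j))) (ocube t) := by
  have hcrit := (atomConvergence (p + t) q a e hq).mp hI
  constructor
  · by_cases h1 : q₁ = 0
    · subst h1; exact integrableOn_atomQ_zero _ _
    refine (atomConvergence p q₁ (fun i => a (Fin.castAdd t i))
      (fun i j => e (Fin.castAdd t i) (Fin.castAdd t j)) h1).mpr fun i j hij => ?_
    have h := hcrit (Fin.castAdd t i) (Fin.castAdd t j) ((castAdd_le_castAdd_iff i j).mpr hij)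
    rw [crit_castAdd] at h
    simpa using h
  · by_cases h2 : q₂ = 0
    · subst h2; exact integrableOn_atomQ_zero _ _
    refine (atomConvergence t q₂ (fun i => a (Fin.natAdd p i))
      (fun i j => e (Fin.natAdd p i) (Fin.natAdd p j)) h2).mpr fun i j hij => ?_
    have h := hcrit (Fin.natAdd p i) (Fin.natAdd p j) ((Fin.natAdd_le_natAdd_iff p).mpr hij)
    rw [crit_natAdd] at h
    simp only [Fin.val_natAdd, Nat.cast_add] at h
    convert h using 2
    ring

/-! ## The product representation of the blocks -/

/-- The cube of dimension `p + t` is the product of the cubes of dimensions `p` and `t`. -/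
theorem prodDomain_eq_ocube (s₁ : KZ.IntegralRep p) (s₂ : KZ.IntegralRep t)
    (h₁ : s₁.domain = ocube p) (h₂ : s₂.domain = ocube t) :
    KZ.IntegralRep.prodDomain s₁ s₂ = ocube (p + t) := by
  ext z
  rw [KZ.IntegralRep.mem_prodDomain, h₁, h₂]
  simp only [mem_setOf_eq]
  constructor
  · rintro ⟨hl, hr⟩ i
    induction i using Fin.addCases with
    | left i => exact hl i
    | right j => exact hr j
  · intro h
    exact ⟨fun i => h _, fun j => h _⟩

/-- **The split, in dimension `p + t`.**  For a product atom `s` on the cube of dimension `p + t`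
there are block atoms `s₁`, `s₂` (dimensions `p`, `t`) with `KZ.of s − KZ.of s₁ * KZ.of s₂ ∈
KZ.relations`. -/
theorem split_add (q : ℚ) (a : Fin (p + t) → ℕ) (e : Fin (p + t) → Fin (p + t) → ℤ)
    (s : KZ.IntegralRep (p + t)) (hdom : s.domain = ocube (p + t))
    (hint : EqOn s.integrand (atomQ (p + t) q a e) s.domain)
    (hseam : ∀ i j : Fin (p + t), i ≤ j → (i : ℕ) < p → p ≤ (j : ℕ) → e i j = 0) :
    ∃ (q₂ : ℚ) (h₁ : IntegrableOn (atomQ p q (fun i => a (Fin.castAdd t i))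
        (fun i j => e (Fin.castAdd t i) (Fin.castAdd t j))) (ocube p))
      (h₂ : IntegrableOn (atomQ t q₂ (fun i => a (Fin.natAdd p i))
        (fun i j => e (Fin.natAdd p i) (Fin.natAdd p j))) (ocube t)),
      KZ.of s - KZ.of (atomRep p q (fun i => a (Fin.castAdd t i))
          (fun i j => e (Fin.castAdd t i) (Fin.castAdd t j)) h₁) *
        KZ.of (atomRep t q₂ (fun i => a (Fin.natAdd p i))
          (fun i j => e (Fin.natAdd p i) (Fin.natAdd p j)) h₂) ∈ KZ.relations := by
  by_cases hq : q = 0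
  · -- zero atom: both `KZ.of s` and the product are relations
    subst hq
    refine ⟨0, integrableOn_atomQ_zero _ _, integrableOn_atomQ_zero _ _, ?_⟩
    rw [KZ.of_mul_of]
    refine sub_mem (KZ.of_mem_relations_of_eqOn_zero s fun x hx => by simp [hint hx, atomQ])
      (KZ.of_mem_relations_of_eqOn_zero _ fun x _ => ?_)
    rw [KZ.IntegralRep.prod_integrand_eq, KZ.IntegralRep.prodFun_apply, atomRep_integrand]
    simp [atomQ]
  · have hI : IntegrableOn (atomQ (p + t) q a e) (ocube (p + t)) :=
      hdom ▸ s.integrableOn.congr_fun hint (KZ.IntegralRep.measurableSet_domain_holds s)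
    obtain ⟨h₁, h₂⟩ := integrableOn_blocks hq a e hI q 1
    refine ⟨1, h₁, h₂, ?_⟩
    rw [KZ.of_mul_of]
    refine KZ.of_sub_of_mem_relations_of_eqOn ?_ fun x hx => ?_
    · rw [KZ.IntegralRep.prod_domain, hdom]
      exact prodDomain_eq_ocube _ _ rfl rfl
    · rw [KZ.IntegralRep.prod_integrand_eq, KZ.IntegralRep.prodFun_apply, atomRep_integrand,
        atomRep_integrand, hint hx]
      exact atomQ_split q a e hseam x

end ProductSplit

open ProductSplit in
/-- **`stub_productSplit`** (v5: product atoms are an exit).  A PRODUCT atom — no active chord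
straddles the seam `p`, `0 < p < k` — is congruent modulo `KZ.relations` to the product
`KZ.of s₁ * KZ.of s₂` of two convergent cubical atoms of dimensions `p` and `k − p`, both `< k`:
write `k = p + t`; the integrand factorises into the two block atoms (`ProductSplit.atomQ_split`),
both blocks are absolutely convergent by the convergence criterion `atomConvergence`
(`ProductSplit.integrableOn_blocks`), the cube is the product of the block cubes, so `s` and
`s₁.prod s₂` (`KZ.of_mul_of`, `KZ.IntegralRep.prod_integrand_eq`) differ by a relation
(`KZ.of_sub_of_mem_relations_of_eqOn`). -/
theorem stub_productSplit : ∀ (k : ℕ) (q : ℚ) (a : Fin k → ℕ) (e : Fin k → Fin k → ℤ) (s : Literature.NumberTheory.Transcendental.KZ.IntegralRep k) (p : ℕ), 0 < p → p < k → s.domain = {x : Fin k → ℝ | ∀ i, x i ∈ Set.Ioo (0:ℝ) 1} → Set.EqOn s.integrand (fun x => (q : ℝ) * ((∏ i : Fin k, x i ^ a i) * ∏ i : Fin k, ∏ j : Fin k, if i ≤ j then (1 - (∏ l : Fin k, if i ≤ l ∧ l ≤ j then x l else 1)) ^ e i j else 1)) s.domain → (∀ i j : Fin k, i ≤ j → (i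 : ℕ) < p → p ≤ (j : ℕ) → e i j = 0) → ∃ (d₁ d₂ : ℕ) (s₁ : Literature.NumberTheory.Transcendental.KZ.IntegralRep d₁) (s₂ : Literature.NumberTheory.Transcendental.KZ.IntegralRep d₂), d₁ < k ∧ d₂ < k ∧ Literature.NumberTheory.Transcendental.KZ.of s₁ ∈ {z : Literature.NumberTheory.Transcendental.KZ.FormalRep | ∃ (q : ℚ) (a : Fin d₁ → ℕ) (e : Fin d₁ → Fin d₁ → ℤ) (s : Literature.NumberTheory.Transcendental.KZ.IntegralRep d₁), s.domain = {x : Fin d₁ → ℝ | ∀ i, x i ∈ Set.Ioo (0:ℝ) 1} ∧ Set.EqOn s.integrand (fun x => (q : ℝ) * ((∏ i : Fin d₁, x i ^ a i) * ∏ i : Fin d₁, ∏ j : Fin d₁, if i ≤ j then (1 - (∏ l : Fin d₁, if i ≤ l ∧ l ≤ j then x l else 1)) ^ e i j else 1)) s.domain ∧ z = Literature.NumberTheory.Transcendental.KZ.of s} ∧ Literature.NumberTheory.Transcendental.KZ.of s₂ ∈ {z : Literature.NumberTheory.Transcendental.KZ.FormalRep | ∃ (q : ℚ) (a : Fin d₂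 → ℕ) (e : Fin d₂ → Fin d₂ → ℤ) (s : Literature.NumberTheory.Transcendental.KZ.IntegralRep d₂), s.domain = {x : Fin d₂ → ℝ | ∀ i, x i ∈ Set.Ioo (0:ℝ) 1} ∧ Set.EqOn s.integrand (fun x => (q : ℝ) * ((∏ i : Fin d₂, x i ^ a i) * ∏ i : Fin d₂, ∏ j : Fin d₂, if i ≤ j then (1 - (∏ l : Fin d₂, if i ≤ l ∧ l ≤ j then x l else 1)) ^ e i j else 1)) s.domain ∧ z = Literature.NumberTheory.Transcendental.KZ.of s} ∧ Literature.NumberTheory.Transcendental.KZ.of s - Literature.NumberTheory.Transcendental.KZ.of s₁ * Literature.NumberTheory.Transcendental.KZ.of s₂ ∈ Literature.NumberTheory.Transcendental.KZ.relations := by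
  intro k q a e s p hp hpk hdom hint hseam
  obtain ⟨t, rfl⟩ : ∃ t, k = p + t := ⟨k - p, by omega⟩
  obtain ⟨q₂, h₁, h₂, hrel⟩ := split_add q a e s hdom hint hseam
  exact ⟨p, t, atomRep p q (fun i => a (Fin.castAdd t i))
      (fun i j => e (Fin.castAdd t i) (Fin.castAdd t j)) h₁,
    atomRep t q₂ (fun i => a (Fin.natAdd p i))
      (fun i j => e (Fin.natAdd p i) (Fin.natAdd p j)) h₂,
    by omega, by omega,
    ⟨q, (fun i => a (Fin.castAdd t i)), (fun i j => e (Fin.castAdd t i) (Fin.castAdd t j)), _, rfl,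
      fun x _ => rfl, rfl⟩,
    ⟨q₂, (fun i => a (Fin.natAdd p i)), (fun i j => e (Fin.natAdd p i) (Fin.natAdd p j)), _, rfl,
      fun x _ => rfl, rfl⟩, hrel⟩

end Summit.KontsevichZagierPeriods.DihedralNormalForm.TorusDescent
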